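import Summits.ResolutionOfSingularities.ResolutionOfSingularities.Theorems.FrobeniusLadderFRationalResolutionSuspensionBookkeeping
import Summits.ResolutionOfSingularities.ResolutionOfSingularities.Theorems.FrobeniusLadderFRationalResolutionGlassbrennerQuotient
import Summits.ResolutionOfSingularities.ResolutionOfSingularities.Theorems.FrobeniusLadderFRationalResolutionFrobeniusPowerAtPrime
import Summits.ResolutionOfSingularities.ResolutionOfSingularities.Theorems.FrobeniusLadderFRationalResolutionSuspensionKernel
import Summits.ResolutionOfSingularities.ResolutionOfSingularities.Theorems.FrobeniusLadderFRationalResolutionClauseOfDerivation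
import Mathlib.Algebra.MvPolynomial.Equiv
import Mathlib.Algebra.MvPolynomial.PDeriv
import Mathlib.RingTheory.RegularLocalRing.Polynomial
import HarnessLib

/-!
# Suspension calibration, II: every local ring of `Σf = {yz + f = 0}` is weakly F-regular

Support file for crux stmt-ResolutionOfSingularities-15317 (`FrobeniusLadder.FRationalResolution`),
line `Sketch`, continuation seat c2. MAIN RESULT `suspension_localClause`: for every field `k` of
characteristic `p`, every `n`, every `f ≠ 0` in `k[x₁..xₙ]` and every prime `P ∋ g := yz + f` of
`S = k[y,z,x₁..xₙ] = MvPolynomial (Fin 2 ⊕ Fin n) k`, the local ring `S_P/(g)` is a DOMAIN in which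
EVERY ideal is tightly closed (the crux's clause in weakly-F-regular inline form; all `e`, any
non-zero multiplier).

Proof. Smooth charts `y ∉ P` / `z ∉ P`: `∂g/∂z = y`, `∂g/∂y = z` (`pderiv_suspension`) and the
Jacobian lemma `stub_clause_of_derivation` (regular local rings have all ideals tightly closed, Kunz).
Singular chart `y, z ∈ P`: Glassbrenner's elementwise criterion `stub_glassbrennerQuotient` — for
every `c ∉ (g)` some `q = p^e` has `c g^(q−1) ∉ (P S_P)^[q]`. This is fed by: `(g)` is prime and
every `c ∉ (g)` has a non-zero Laurent coefficient `[T^D] c(T, −f/T)` (`stub_suspensionKernel`, in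
`k[x][y,z]` via `MvPolynomial.sumAlgEquiv`, `sumAlgEquiv_suspension`); the bookkeeping lemma
`exists_notMem_frobeniusPower_ker` (non-membership at the maximal ideal `(𝔞, y, z)`, `𝔞 ⊇ P ∩ k[x]`
maximal); and the descent `stub_notMem_frobeniusPower_atPrime` from `(𝔞, y, z)` to `P` (Frobenius
powers of primes of a regular ring are contracted). No F-finiteness or perfectness of `k` is used:
only Kunz's flatness of Frobenius on regular local rings (in tree).

References: Glassbrenner 1996 (Proc. AMS 124); Hochster–Huneke 1989 (Mém. SMF 38) Thm. 3.3;
Fedder 1983; calibration note `Cruxes/FRationalResolution/NEGATIVE-suspension-calibration.md` (Claim A,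
there for F-finite `k` via splittings; here for every field).
-/

-- single-problem summit: the doubled namespace component `ResolutionOfSingularities` is forced
set_option linter.dupNamespace false

noncomputable section

open Literature.RingTheory.TightClosure Literature.AlgebraicGeometry.Resolution
open scoped BigOperators

namespace Summit.ResolutionOfSingularities.ResolutionOfSingularities.Theorems.FRationalResolution

section Local

open MvPolynomial IsLocalRing

variable (k : Type) [Field k] (n : ℕ)

/-- The suspension polynomial `yz + f` is sent by `MvPolynomial.sumAlgEquiv` to `X 0 * X 1 + C f`. -/
theorem sumAlgEquiv_suspension (f : MvPolynomial (Fin n) k) :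
    sumAlgEquiv k (Fin 2) (Fin n)
      (X (Sum.inl 0) * X (Sum.inl 1) + rename Sum.inr f : MvPolynomial (Fin 2 ⊕ Fin n) k) =
      X 0 * X 1 + C f := by
  have h : sumAlgEquiv k (Fin 2) (Fin n) (rename Sum.inr f) = C f := by
    have := congrArg (fun φ => φ f) (sumAlgEquiv_comp_rename_inr (R := k) (S₁ := Fin 2) (S₂ := Fin n))
    simpa using this
  rw [map_add, map_mul, sumAlgEquiv_X_inl, sumAlgEquiv_X_inl, h]

/-- The partial derivatives `∂/∂y`, `∂/∂z` kill polynomials in the `x`-variables only. -/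
theorem pderiv_inl_rename_inr (i : Fin 2) (f : MvPolynomial (Fin n) k) :
    pderiv (Sum.inl i) (rename Sum.inr f : MvPolynomial (Fin 2 ⊕ Fin n) k) = 0 := by
  induction f using MvPolynomial.induction_on with
  | C a => simp
  | add p q hp hq => simp [map_add, hp, hq]
  | mul_X p j hp =>
    rw [map_mul, rename_X, Derivation.leibniz, hp, pderiv_X_of_ne (by simp)]
    simp

/-- `∂(yz + f)/∂z = y` and `∂(yz + f)/∂y = z`. -/
theorem pderiv_suspension (f : MvPolynomial (Fin n) k) :
    pderiv (Sum.inl 1)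
        (X (Sum.inl 0) * X (Sum.inl 1) + rename Sum.inr f : MvPolynomial (Fin 2 ⊕ Fin n) k) =
      X (Sum.inl 0) ∧
    pderiv (Sum.inl 0)
        (X (Sum.inl 0) * X (Sum.inl 1) + rename Sum.inr f : MvPolynomial (Fin 2 ⊕ Fin n) k) =
      X (Sum.inl 1) := by
  have h01 : (Sum.inl 1 : Fin 2 ⊕ Fin n) ≠ Sum.inl 0 := by simp
  have h10 : (Sum.inl 0 : Fin 2 ⊕ Fin n) ≠ Sum.inl 1 := by simp
  constructor
  · rw [map_add, pderiv_inl_rename_inr, add_zero, pderiv_mul, pderiv_X_self, pderiv_X_of_ne h10]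
    simp
  · rw [map_add, pderiv_inl_rename_inr, add_zero, pderiv_mul, pderiv_X_self, pderiv_X_of_ne h01]
    simp


/-- **The local clause at every point of the suspension.** For every field `k` of characteristic
`p`, every `f ≠ 0` in `k[x₁..xₙ]` and every prime `P ∋ g := yz + f` of `S = k[y,z,x₁..xₙ]`, the
local ring `S_P/(g)` of the hypersurface `Σf = {yz + f = 0}` at `P` is a domain in which EVERY
ideal is tightly closed (inline form). Smooth charts (`y ∉ P` or `z ∉ P`): Jacobian criterion
`stub_clause_of_derivation`. Singular chart (`y, z ∈ P`): Glassbrenner's elementwise criterion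
`stub_glassbrennerQuotient`, fed for every `c ∉ (g)` by the coefficient computation
(`stub_suspensionKernel` + `exists_notMem_frobeniusPower_ker`) at the maximal ideal
`(𝔪_x, y, z) ⊇ P` and moved down to `P` by `stub_notMem_frobeniusPower_atPrime`. -/
theorem suspension_localClause (k : Type) [Field k] (n : ℕ) (p : ℕ) [Fact p.Prime] [CharP k p]
    (f : MvPolynomial (Fin n) k) (hf : f ≠ 0) (P : Ideal (MvPolynomial (Fin 2 ⊕ Fin n) k)) [P.IsPrime]
    (hgP : (MvPolynomial.X (Sum.inl 0) * MvPolynomial.X (Sum.inl 1) + MvPolynomial.rename Sum.inr f :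
      MvPolynomial (Fin 2 ⊕ Fin n) k) ∈ P) :
    let Q := Localization.AtPrime P ⧸ Ideal.span {algebraMap (MvPolynomial (Fin 2 ⊕ Fin n) k)
      (Localization.AtPrime P)
      (MvPolynomial.X (Sum.inl 0) * MvPolynomial.X (Sum.inl 1) + MvPolynomial.rename Sum.inr f)}
    IsDomain Q ∧ ∀ (I : Ideal Q) (y c : Q), c ≠ 0 →
      (∀ e : ℕ, c * y ^ p ^ e ∈ Ideal.span ((fun z : Q => z ^ p ^ e) '' (I : Set Q))) → y ∈ I := by
  intro Q
  have hp := (Fact.out : p.Prime)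
  -- smooth charts
  by_cases h0 : (X (Sum.inl 0) : (MvPolynomial (Fin 2 ⊕ Fin n) k)) ∈ P
  swap
  · exact stub_clause_of_derivation p k (MvPolynomial (Fin 2 ⊕ Fin n) k) P (pderiv (Sum.inl 1)) (MvPolynomial.X (Sum.inl 0) * MvPolynomial.X (Sum.inl 1) +
      MvPolynomial.rename Sum.inr f : MvPolynomial (Fin 2 ⊕ Fin n) k) hgP
      (by rw [(pderiv_suspension k n f).1]; exact h0)
  by_cases h1 : (X (Sum.inl 1) : (MvPolynomial (Fin 2 ⊕ Fin n) k)) ∈ P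
  swap
  · exact stub_clause_of_derivation p k (MvPolynomial (Fin 2 ⊕ Fin n) k) P (pderiv (Sum.inl 0)) (MvPolynomial.X (Sum.inl 0) * MvPolynomial.X (Sum.inl 1) +
      MvPolynomial.rename Sum.inr f : MvPolynomial (Fin 2 ⊕ Fin n) k) hgP
      (by rw [(pderiv_suspension k n f).2]; exact h1)
  -- singular chart: `y, z ∈ P`
  set e := sumAlgEquiv k (Fin 2) (Fin n) with he
  set g₂ : MvPolynomial (Fin 2) (MvPolynomial (Fin n) k) := X 0 * X 1 + C f with hg₂
  have heg : e (MvPolynomial.X (Sum.inl 0) * MvPolynomial.X (Sum.inl 1) +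
      MvPolynomial.rename Sum.inr f : MvPolynomial (Fin 2 ⊕ Fin n) k) = g₂ := sumAlgEquiv_suspension k n f
  have hegs : e.symm g₂ = (MvPolynomial.X (Sum.inl 0) * MvPolynomial.X (Sum.inl 1) +
      MvPolynomial.rename Sum.inr f : MvPolynomial (Fin 2 ⊕ Fin n) k) := by rw [← heg, e.symm_apply_apply]
  obtain ⟨hprime₂, hker₂⟩ := stub_suspensionKernel (MvPolynomial (Fin n) k) f hf
  -- `(g)` is prime in `S`: it is the preimage of `(g₂)` under `e`
  have hspan : Ideal.span {(MvPolynomial.X (Sum.inl 0) * MvPolynomial.X (Sum.inl 1) +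
      MvPolynomial.rename Sum.inr f : MvPolynomial (Fin 2 ⊕ Fin n) k)} =
      (Ideal.span {g₂}).comap (e : (MvPolynomial (Fin 2 ⊕ Fin n) k) →+* MvPolynomial (Fin 2) (MvPolynomial (Fin n) k)) := by
    apply le_antisymm
    · rw [Ideal.span_singleton_le_iff_mem, Ideal.mem_comap]
      change e (MvPolynomial.X (Sum.inl 0) * MvPolynomial.X (Sum.inl 1) +
      MvPolynomial.rename Sum.inr f : MvPolynomial (Fin 2 ⊕ Fin n) k) ∈ Ideal.span {g₂}
      rw [heg]
      exact Ideal.mem_span_singleton_self g₂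
    · intro x hx
      rw [Ideal.mem_comap] at hx
      obtain ⟨r, hr⟩ := Ideal.mem_span_singleton'.mp hx
      have hx' : x = e.symm r * (MvPolynomial.X (Sum.inl 0) * MvPolynomial.X (Sum.inl 1) +
      MvPolynomial.rename Sum.inr f : MvPolynomial (Fin 2 ⊕ Fin n) k) := by
        have := congrArg e.symm hr
        rw [map_mul, hegs] at this
        rw [this]
        exact (e.symm_apply_apply x).symm
      rw [hx']
      exact Ideal.mul_mem_left _ _ (Ideal.mem_span_singleton_self _)
  haveI hprime : (Ideal.span {(MvPolynomial.X (Sum.inl 0) * MvPolynomial.X (Sum.inl 1) +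
      MvPolynomial.rename Sum.inr f : MvPolynomial (Fin 2 ⊕ Fin n) k)}).IsPrime := by rw [hspan]; exact Ideal.comap_isPrime _ _
  -- domain
  have hdisj : Disjoint (P.primeCompl : Set (MvPolynomial (Fin 2 ⊕ Fin n) k)) (Ideal.span {(MvPolynomial.X (Sum.inl 0) * MvPolynomial.X (Sum.inl 1) +
      MvPolynomial.rename Sum.inr f : MvPolynomial (Fin 2 ⊕ Fin n) k)} : Set (MvPolynomial (Fin 2 ⊕ Fin n) k)) := by
    rw [Set.disjoint_left]
    intro s hs hsg
    exact hs ((Ideal.span_singleton_le_iff_mem _).mpr hgP hsg)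
  have hmapspan : (Ideal.span {(MvPolynomial.X (Sum.inl 0) * MvPolynomial.X (Sum.inl 1) +
      MvPolynomial.rename Sum.inr f : MvPolynomial (Fin 2 ⊕ Fin n) k)}).map (algebraMap (MvPolynomial (Fin 2 ⊕ Fin n) k) (Localization.AtPrime P)) =
      Ideal.span {algebraMap (MvPolynomial (Fin 2 ⊕ Fin n) k) (Localization.AtPrime P) (MvPolynomial.X (Sum.inl 0) * MvPolynomial.X (Sum.inl 1) +
      MvPolynomial.rename Sum.inr f : MvPolynomial (Fin 2 ⊕ Fin n) k)} := by
    rw [Ideal.map_span, Set.image_singleton]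
  haveI : (Ideal.span {algebraMap (MvPolynomial (Fin 2 ⊕ Fin n) k) (Localization.AtPrime P) (MvPolynomial.X (Sum.inl 0) * MvPolynomial.X (Sum.inl 1) +
      MvPolynomial.rename Sum.inr f : MvPolynomial (Fin 2 ⊕ Fin n) k)}).IsPrime := by
    rw [← hmapspan]
    exact IsLocalization.isPrime_of_isPrime_disjoint P.primeCompl _ _ hprime hdisj
  refine ⟨Ideal.Quotient.isDomain _, ?_⟩
  -- Glassbrenner
  haveI : CharP (Localization.AtPrime P) p := charP_of_injective_algebraMap' (MvPolynomial (Fin 2 ⊕ Fin n) k) p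
  refine stub_glassbrennerQuotient p (Localization.AtPrime P)
    (algebraMap (MvPolynomial (Fin 2 ⊕ Fin n) k) (Localization.AtPrime P) (MvPolynomial.X (Sum.inl 0) * MvPolynomial.X (Sum.inl 1) +
      MvPolynomial.rename Sum.inr f : MvPolynomial (Fin 2 ⊕ Fin n) k)) ?_
  intro c hc
  obtain ⟨c₀, u, rfl⟩ := IsLocalization.exists_mk'_eq P.primeCompl c
  -- `c₀ ∉ (g)`
  have hc₀ : c₀ ∉ Ideal.span {(MvPolynomial.X (Sum.inl 0) * MvPolynomial.X (Sum.inl 1) +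
      MvPolynomial.rename Sum.inr f : MvPolynomial (Fin 2 ⊕ Fin n) k)} := by
    intro hmem
    apply hc
    have : IsLocalization.mk' (Localization.AtPrime P) c₀ u =
        IsLocalization.mk' (Localization.AtPrime P) 1 u * algebraMap (MvPolynomial (Fin 2 ⊕ Fin n) k) (Localization.AtPrime P) c₀ := by
      rw [mul_comm, IsLocalization.mul_mk'_eq_mk'_of_mul, mul_one]
    rw [this, ← hmapspan]
    exact Ideal.mul_mem_left _ _ (Ideal.mem_map_of_mem _ hmem)
  -- hence `e c₀ ∉ (g₂)` and some Laurent coefficient is non-zero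
  have hec₀ : e c₀ ∉ Ideal.span {g₂} := by
    intro hmem
    apply hc₀
    rw [hspan, Ideal.mem_comap]
    exact hmem
  obtain ⟨D, hD⟩ := hker₂ (e c₀) hec₀
  -- the prime `P₂ = e(P) ∋ y, z`, `𝔮 = P₂ ∩ A` and a maximal ideal `𝔞 ⊇ 𝔮`
  set P₂ : Ideal (MvPolynomial (Fin 2) (MvPolynomial (Fin n) k)) :=
    P.comap (e.symm : MvPolynomial (Fin 2) (MvPolynomial (Fin n) k) →+* (MvPolynomial (Fin 2 ⊕ Fin n) k)) with hP₂
  have hmemP₂ : ∀ h : (MvPolynomial (Fin 2 ⊕ Fin n) k), h ∈ P → e h ∈ P₂ := fun h hh => by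
    rw [hP₂, Ideal.mem_comap]
    change e.symm (e h) ∈ P
    rwa [e.symm_apply_apply]
  have hX0 : (X 0 : MvPolynomial (Fin 2) (MvPolynomial (Fin n) k)) ∈ P₂ := by
    have := hmemP₂ _ h0
    rwa [he, sumAlgEquiv_X_inl] at this
  have hX1 : (X 1 : MvPolynomial (Fin 2) (MvPolynomial (Fin n) k)) ∈ P₂ := by
    have := hmemP₂ _ h1
    rwa [he, sumAlgEquiv_X_inl] at this
  set 𝔮 : Ideal (MvPolynomial (Fin n) k) :=
    P₂.comap (C : MvPolynomial (Fin n) k →+* MvPolynomial (Fin 2) (MvPolynomial (Fin n) k)) with h𝔮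
  have h𝔮ne : 𝔮 ≠ ⊤ := Ideal.IsPrime.ne_top (Ideal.comap_isPrime _ _)
  obtain ⟨𝔞, h𝔞max, h𝔮𝔞⟩ := Ideal.exists_le_maximal 𝔮 h𝔮ne
  -- the maximal ideal `M₂ = 𝔞 + (y, z)` of `A[y,z]` and its pull-back `M` to `S`
  set M₂ : Ideal (MvPolynomial (Fin 2) (MvPolynomial (Fin n) k)) :=
    𝔞.comap (constantCoeff : MvPolynomial (Fin 2) (MvPolynomial (Fin n) k) →+* MvPolynomial (Fin n) k)
    with hM₂
  haveI hM₂max : M₂.IsMaximal :=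
    Ideal.comap_isMaximal_of_surjective _ (fun a => ⟨C a, constantCoeff_C _ a⟩)
  set M : Ideal (MvPolynomial (Fin 2 ⊕ Fin n) k) := M₂.comap (e : (MvPolynomial (Fin 2 ⊕ Fin n) k) →+* MvPolynomial (Fin 2) (MvPolynomial (Fin n) k)) with hM
  haveI hMmax : M.IsMaximal := Ideal.comap_isMaximal_of_surjective _ e.surjective
  have hPM : P ≤ M := by
    intro h hh
    rw [hM, Ideal.mem_comap, hM₂, Ideal.mem_comap]
    apply h𝔮𝔞
    rw [h𝔮, Ideal.mem_comap, ← mem_iff_C_constantCoeff_mem hX0 hX1]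
    exact hmemP₂ h hh
  -- non-membership at `M₂`, transported to `M`
  obtain ⟨e₀, he₀⟩ := exists_notMem_frobeniusPower_ker p f hf 𝔞 h𝔞max.ne_top (e c₀) D hD
  have hsM : c₀ * (MvPolynomial.X (Sum.inl 0) * MvPolynomial.X (Sum.inl 1) +
      MvPolynomial.rename Sum.inr f : MvPolynomial (Fin 2 ⊕ Fin n) k) ^ (p ^ e₀ - 1) ∉ frobeniusPower (p ^ e₀) M := by
    intro hmem
    apply he₀
    have h2 : e (c₀ * (MvPolynomial.X (Sum.inl 0) * MvPolynomial.X (Sum.inl 1) +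
      MvPolynomial.rename Sum.inr f : MvPolynomial (Fin 2 ⊕ Fin n) k) ^ (p ^ e₀ - 1)) ∈ (frobeniusPower (p ^ e₀) M).map
        (e : (MvPolynomial (Fin 2 ⊕ Fin n) k) →+* MvPolynomial (Fin 2) (MvPolynomial (Fin n) k)) := Ideal.mem_map_of_mem _ hmem
    rw [map_mul, map_pow, heg] at h2
    have hMM₂ : M.map (e : (MvPolynomial (Fin 2 ⊕ Fin n) k) →+* MvPolynomial (Fin 2) (MvPolynomial (Fin n) k)) = M₂ := by
      rw [hM]
      exact Ideal.map_comap_of_surjective (e : (MvPolynomial (Fin 2 ⊕ Fin n) k) →+* MvPolynomial (Fin 2) (MvPolynomial (Fin n) k))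
        e.surjective M₂
    -- Frobenius power commutes with the isomorphism
    have h3 : (frobeniusPower (p ^ e₀) M).map (e : (MvPolynomial (Fin 2 ⊕ Fin n) k) →+* MvPolynomial (Fin 2) (MvPolynomial (Fin n) k)) =
        frobeniusPower (p ^ e₀) M₂ := by
      rw [← hMM₂, frobeniusPower_eq_map_iterateFrobenius, frobeniusPower_eq_map_iterateFrobenius,
        Ideal.map_map, Ideal.map_map]
      congr 1
      refine RingHom.ext fun a => ?_
      simp [iterateFrobenius_def, map_pow]
    rw [h3] at h2
    exact h2
  -- down to `S_P`
  have hloc := stub_notMem_frobeniusPower_atPrime p (MvPolynomial (Fin 2 ⊕ Fin n) k) P M hPM e₀ _ hsM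
  refine ⟨e₀, fun hmem => hloc ?_⟩
  rw [map_mul, map_pow]
  have hu : algebraMap (MvPolynomial (Fin 2 ⊕ Fin n) k) (Localization.AtPrime P) u * IsLocalization.mk' (Localization.AtPrime P) c₀ u =
      algebraMap (MvPolynomial (Fin 2 ⊕ Fin n) k) (Localization.AtPrime P) c₀ :=
    IsLocalization.mk'_spec' (Localization.AtPrime P) c₀ u
  rw [← hu, mul_assoc]
  exact Ideal.mul_mem_left _ _ hmem

end Local

end Summit.ResolutionOfSingularities.ResolutionOfSingularities.Theorems.FRationalResolution

end
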